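import Summits.CriticalPhenomena.SAWScalingLimit.Theorems.TubeLowerBound.Negative.SubcriticalRenewalFloorTargets

/-!
# Crux `SAWRenewalTightness.TubeLowerBound` (stmt-CriticalPhenomena-4730): objects of the line `lieb-simon-star`

Definitions (statements only — no stub is asserted or proved here) used by the positive-side files of this
crux, i.e. by the registered stubs of the checked skeleton
`Summits/CriticalPhenomena/SAWScalingLimit/Cruxes/TubeLowerBound/Lines/lieb-simon-star.lean` (lead
`prover-line-stmt-CriticalPhenomena-4730-0`, `ledger skeleton check` 2026-08-16) and by its composition theorem
`TubeLowerBound_of`: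

* §A the chain of floors of the line: `CornerCrossingFloor` (S1, the one open RSW-type input: corner-started,
  rectangle-confined, point-to-column `x_c`-mass, aspect existential), `OneSidedReach` (output of the steered
  chain S2), `HalfTubePieceFloor` (output of the mirror pin S3), `FirstOctantTubeFloor` (output of the corner
  staircase S4b) and `TightTubeFloor` (the crux at its own scale `ℓ₀ = max(1,|u−v|)`; `↔ TubeLowerBound` by the
  landed `Negative.tightTubeFloor_iff`);
* §B the Simon–Lieb statements `LiebSimonFloor` (first-exit mass of the open `R`-box is `≥ 1` at `x_c`),
  `QuarterFlux` (a quarter of it through the east side) and `DominoFloor` (reflect-and-Schwarz: a pointwise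
  polynomial floor for walks `0 → (2R+1)e₁` inside the domino `[−R,3R+1] × [−R,R]`), with the sup-norm `supNorm`.

All statements are over tree vocabulary (`SAW.Zd.saws`, `SAW.Zd.sawFun`, `SAW.criticalFugacity`,
`Site.toComplex`), every floor in the `∃ N` partial-sum form with `0 ≤ C` where an exponent occurs (cf. the landed
`Negative.constraints`, `Negative.not_allN`).  Statements §A are verbatim those of the planner's checked skeleton
(planner-cruxplan-stmt-CriticalPhenomena-4730-lieb-simon-star) except `FirstOctantTubeFloor` (lead reshape: the
`u = 0`, `v = (a,b)`, `0 ≤ b ≤ a` instance of `TightTubeFloor`).  Sources for §B: N. Madras, G. Slade, *The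
Self-Avoiding Walk* (1993), Lemma A.1 (Lieb–Simon inequality) and Lemma 4.1.12 (reflect-and-Schwarz); B. Simon,
Comm. Math. Phys. 77 (1980); E. Lieb, Comm. Math. Phys. 77 (1980).
-/

noncomputable section

namespace Summit.CriticalPhenomena.SAWScalingLimit.Theorems.TubeLowerBound.LiebSimonStar

open scoped BigOperators Classical
open Literature.Probability.LatticeModels
open Literature.Probability.RandomPlanarGeometry Literature.Probability.RandomPlanarGeometry.SAW
open Summit.CriticalPhenomena.SAWScalingLimit.Theses.SAWRenewalTightness (TubeLowerBound)

/-! ## A. The chain of floors -/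

/-- **`CornerCrossingFloor`** (statement of the open stub S1).  There are `K : ℕ` and `C ≥ 0`, `c > 0` such that
for every width `a ≥ 1` some partial sum of the `x_c`-mass of self-avoiding walks `ω` from `0` — the south-west
corner — all of whose vertices lie in the closed rectangle `[0, a] × [0, K a]` and whose last vertex lies on the east
column `x = a` is at least `c a^{−C}` (not first passage: earlier visits to the column `x = a` are allowed). -/
def CornerCrossingFloor : Prop :=
  ∃ (K : ℕ) (C c : ℝ), 0 ≤ C ∧ 0 < c ∧ ∀ a : ℕ, 1 ≤ a → ∃ N : ℕ,
    c * (a : ℝ) ^ (-C) ≤ ∑ n ∈ Finset.range (N + 1),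
      ∑ _ω ∈ (Zd.saws 2 n).filter (fun ω =>
          (∀ i ≤ n, 0 ≤ ω i 0 ∧ ω i 0 ≤ (a : ℤ) ∧ 0 ≤ ω i 1 ∧ ω i 1 ≤ (K : ℤ) * a) ∧ ω n 0 = (a : ℤ)),
        criticalFugacity ^ n

/-- **`OneSidedReach`** (output of S2, input of S3): corner-to-column crossing of the FLAT box of aspect `5`.
There are `C ≥ 0`, `c > 0` such that for every `X ≥ 1` some partial sum of the `x_c`-mass of self-avoiding walks
from `0` all of whose vertices satisfy `0 ≤ x ≤ X`, `0 ≤ y`, `5 y ≤ X`, and whose last vertex lies on the column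
`x = X`, is at least `c X^{−C}`. -/
def OneSidedReach : Prop :=
  ∃ C c : ℝ, 0 ≤ C ∧ 0 < c ∧ ∀ X : ℕ, 1 ≤ X → ∃ N : ℕ,
    c * (X : ℝ) ^ (-C) ≤ ∑ n ∈ Finset.range (N + 1),
      ∑ _ω ∈ (Zd.saws 2 n).filter (fun ω =>
          (∀ i ≤ n, 0 ≤ ω i 0 ∧ ω i 0 ≤ (X : ℤ) ∧ 0 ≤ ω i 1 ∧ 5 * ω i 1 ≤ (X : ℤ)) ∧ ω n 0 = (X : ℤ)),
        criticalFugacity ^ n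

/-- **`HalfTubePieceFloor`** (output of S3, input of S4b): POINTWISE one-sided flat pieces.  There are `C ≥ 0`,
`c > 0` such that for every `L ≥ 1` some partial sum of the `x_c`-mass of self-avoiding walks `0 → (L, 0)` all of
whose vertices lie in the closed half-tube `[0, L] × [0, L/10]` (`0 ≤ x ≤ L`, `0 ≤ y`, `10 y ≤ L`) is at least
`c L^{−C}`. -/
def HalfTubePieceFloor : Prop :=
  ∃ C c : ℝ, 0 ≤ C ∧ 0 < c ∧ ∀ L : ℕ, 1 ≤ L → ∃ N : ℕ,
    c * (L : ℝ) ^ (-C) ≤ ∑ n ∈ Finset.range (N + 1),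
      ∑ _ω ∈ (Zd.sawFun 2 n ![(L : ℤ), 0]).filter (fun ω =>
          ∀ i ≤ n, 0 ≤ ω i 0 ∧ ω i 0 ≤ (L : ℤ) ∧ 0 ≤ ω i 1 ∧ 10 * ω i 1 ≤ (L : ℤ)),
        criticalFugacity ^ n

/-- **`FirstOctantTubeFloor`** (output of S4b, input of S4a): `TightTubeFloor` specialised to `u = 0`, `v = (a, b)`
with naturals `b ≤ a` (the first octant), without the `u +` / `v − u` bookkeeping: there are `C ≥ 0`, `c > 0` such
that for all `a b : ℕ` with `b ≤ a`, with `ℓ₀ := max(1, |(a,b)|)`, some partial sum of the `x_c`-mass of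
self-avoiding walks `0 → (a, b)` all of whose vertices lie within `ℓ₀/10 + 2` of the segment `[0, (a,b)]` is
`≥ c ℓ₀^{−C}`. -/
def FirstOctantTubeFloor : Prop :=
  ∃ C c : ℝ, 0 ≤ C ∧ 0 < c ∧ ∀ a b : ℕ, b ≤ a → ∃ N : ℕ,
    c * (max 1 (dist (Site.toComplex (0 : Site 2)) (Site.toComplex (![(a : ℤ), (b : ℤ)] : Site 2)))) ^ (-C) ≤
      ∑ n ∈ Finset.range (N + 1), ∑ _ω ∈ (Zd.sawFun 2 n (![(a : ℤ), (b : ℤ)] : Site 2)).filter (fun ω => ∀ i ≤ n,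
          Metric.infDist (Site.toComplex (ω i))
            (segment ℝ (Site.toComplex (0 : Site 2)) (Site.toComplex (![(a : ℤ), (b : ℤ)] : Site 2))) ≤
            max 1 (dist (Site.toComplex (0 : Site 2)) (Site.toComplex (![(a : ℤ), (b : ℤ)] : Site 2))) / 10 + 2),
        criticalFugacity ^ n

/-- **`TightTubeFloor`** — the crux at its own scale (output of S4a; the same text as the left side of the landed
`Negative.tightTubeFloor_iff`, so `TightTubeFloor ↔ TubeLowerBound`): there are `C ≥ 0` and `c > 0` such that for
all `u, v ∈ ℤ²`, with `ℓ₀ := max(1, |u − v|)`, some partial sum of the `x_c`-mass of self-avoiding walks `u → v`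
all of whose vertices lie within `ℓ₀/10 + 2` of the segment `[u, v]` is `≥ c ℓ₀^{−C}`. -/
def TightTubeFloor : Prop :=
  ∃ C c : ℝ, 0 ≤ C ∧ 0 < c ∧ ∀ (u v : Site 2), ∃ N : ℕ,
    c * (max 1 (dist (Site.toComplex u) (Site.toComplex v))) ^ (-C) ≤
      ∑ n ∈ Finset.range (N + 1), ∑ _ω ∈ (Zd.sawFun 2 n (v - u)).filter (fun ω => ∀ i ≤ n,
          Metric.infDist (Site.toComplex (u + ω i)) (segment ℝ (Site.toComplex u) (Site.toComplex v)) ≤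
            max 1 (dist (Site.toComplex u) (Site.toComplex v)) / 10 + 2),
        criticalFugacity ^ n

/-- **`TightTubeFloor ↔ TubeLowerBound`**: the line's last statement IS the crux (registered sub-goal; the landed
`Negative.tightTubeFloor_iff` states exactly this with `TightTubeFloor` inlined). -/
theorem tightTubeFloor_iff_crux : TightTubeFloor ↔ TubeLowerBound :=
  Summit.CriticalPhenomena.SAWScalingLimit.Theorems.TubeLowerBound.Negative.tightTubeFloor_iff

/-! ## B. The Simon–Lieb statements -/

/-- Sup-norm `max(|x|, |y|)` of a site of `ℤ²`. -/
def supNorm (y : Site 2) : ℤ := max |y 0| |y 1|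

/-- **`LiebSimonFloor`**.  For every `R ≥ 1` the `x_c`-mass of self-avoiding walks from `0` that stay in the open
box `‖·‖∞ < R` before their last vertex and whose last vertex lies on `‖·‖∞ = R` (first-exit walks; they have
`≤ (2R−1)²` steps) is `≥ 1`.  (The Lieb–Simon inequality run backwards at criticality: otherwise cutting every SAW
at its first exit of the box would give `c_n x_c^n → 0`, against `μ^n ≤ c_n`.) -/
def LiebSimonFloor : Prop :=
  ∀ R : ℕ, 1 ≤ R → (1 : ℝ) ≤ ∑ n ∈ Finset.range ((2 * R - 1) ^ 2 + 1),
    ∑ _ω ∈ (Zd.saws 2 n).filter (fun ω => (∀ i < n, supNorm (ω i) < (R : ℤ)) ∧ supNorm (ω n) = (R : ℤ)),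
      criticalFugacity ^ n

/-- **`QuarterFlux`**: the first-exit walks of the open `R`-box leaving through the EAST side `x = R` carry
`x_c`-mass `≥ 1/4` (`LiebSimonFloor` plus the order-4 rotation symmetry of `(ℤ², box, x_c^{|ω|})`). -/
def QuarterFlux : Prop :=
  ∀ R : ℕ, 1 ≤ R → (1 : ℝ) / 4 ≤ ∑ n ∈ Finset.range ((2 * R - 1) ^ 2 + 1),
    ∑ _ω ∈ (Zd.saws 2 n).filter (fun ω => (∀ i < n, supNorm (ω i) < (R : ℤ)) ∧ ω n 0 = (R : ℤ)),
      criticalFugacity ^ n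

/-- **`DominoFloor`** (the unconditional pointwise fat-tube floor on the axis): for every `R ≥ 1` the `x_c`-mass of
self-avoiding walks `0 → (2R+1, 0)` confined to the domino `[−R, 3R+1] × [−R, R]` is `≥ x_c / (16 (2R+1))` — an
east-exit fan of the `R`-box, one bridging edge, and the reversed mirror image in `x = R + 1/2` of a second east-exit
fan with the same exit height; Cauchy–Schwarz over the exit heights and `QuarterFlux`. -/
def DominoFloor : Prop :=
  ∀ R : ℕ, 1 ≤ R → criticalFugacity / (16 * (2 * (R : ℝ) + 1)) ≤
    ∑ n ∈ Finset.range (2 * (2 * R - 1) ^ 2 + 2),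
      ∑ _ω ∈ (Zd.sawFun 2 n ![2 * (R : ℤ) + 1, 0]).filter
        (fun ω => ∀ i ≤ n, -(R : ℤ) ≤ ω i 0 ∧ ω i 0 ≤ 3 * (R : ℤ) + 1 ∧ |ω i 1| ≤ (R : ℤ)),
      criticalFugacity ^ n

end Summit.CriticalPhenomena.SAWScalingLimit.Theorems.TubeLowerBound.LiebSimonStar

end
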